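import Summits.QuantumAdvantage.QuantumAdvantage.Theorems.CubicForrelationNearExactIsExactLadderSummary
import Summits.QuantumAdvantage.QuantumAdvantage.Theorems.CubicForrelationNearExactIsExactTwelveClosed5964
import Summits.QuantumAdvantage.QuantumAdvantage.Theorems.CubicForrelationNearExactIsExactTwelveClosed943
import Summits.QuantumAdvantage.QuantumAdvantage.Theorems.CubicForrelationNearExactIsExactTwelveClosed941
import Summits.QuantumAdvantage.QuantumAdvantage.Theorems.CubicForrelationNearExactIsExactTwelveClosed937
import Summits.QuantumAdvantage.QuantumAdvantage.Theorems.CubicForrelationNearExactIsExactTwelveClosed936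
import Summits.QuantumAdvantage.QuantumAdvantage.Theorems.CubicForrelationNearExactIsExactTwelveClosed935
import Summits.QuantumAdvantage.QuantumAdvantage.Theorems.CubicForrelationNearExactIsExactTwelveClosed934
import Summits.QuantumAdvantage.QuantumAdvantage.Theorems.CubicForrelationNearExactIsExactTwelveClosed933
import Summits.QuantumAdvantage.QuantumAdvantage.Theorems.CubicForrelationNearExactIsExactTwelveOpen932
import Summits.QuantumAdvantage.QuantumAdvantage.Theorems.CubicForrelationNearExactIsExactTwelveClosed932
import Summits.QuantumAdvantage.QuantumAdvantage.Theorems.CubicForrelationNearExactIsExactTwelveClosed931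
import Summits.QuantumAdvantage.QuantumAdvantage.Theorems.CubicForrelationNearExactIsExactTwelveClosed930
import Summits.QuantumAdvantage.QuantumAdvantage.Theorems.CubicForrelationNearExactIsExactTwelveClosed929
import Summits.QuantumAdvantage.QuantumAdvantage.Theorems.CubicForrelationNearExactIsExactTwelveBetaDead

/-!
# Crux `CubicForrelation.NearExactIsExact` (stmt-QuantumAdvantage-14043) — the certified `θ_n` ladder, index REFRESH (2026-08-20, after gen 15)

Certificate seat `b2b-cforr-cert` (gen 15).  HONEST FRAMING: this file adds NO new mathematics.  It re-packages the table of
`…LadderSummary.lean` (gen 11) with the one row that has moved since: **`n = 12`**.  NOT summit progress: the crux asks for ONE `θ < 1`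
uniform in `n`; every finite-slice bound tends to `1`.

| `n` | verdict | deciding declarations (namespace `…Theorems.CubicForrelation.NearExactIsExact`) |
|-----|---------|--------------------------------------------------------------------------------------|
| `2, 4, 6, 8, 10` | `θ₂ = 1/2`ᶜ, `θ₄ = 3/4`ᶜ, `θ₆ = 25/32`ᶜ, `θ₈ = 13/16`, `θ₁₀ = 7/8` | unchanged, see `…LadderSummary.lean` (ᶜ = compiled certificate) |
| `12` | **`θ₁₂ ∈ [57/64, 59/64)`**; the values `59/64 = 944/1024, …, 1023/1024` are NOT attained; open: `913/1024 … 943/1024` | `isolation_twelve_ge_5964` (`Φ ≥ 59/64 ⇒ Φ = 1`, CLOSED; TwelveClosed5964, gen 15: level-5 `tw15_levelFive_ge_false`, type-O `to15_typeO_ge_false`, level-`≥6` `tw15_levelSix_5964_false`), `theta_twelve_halfopen_5964`; earlier steps `isolation_twelve_closed` (15/16, gen 8), `to12_typeO_le` (gen 12), `isolation_twelve_953` (gen 13), `isolation_twelve_5964` (gen 14); record `57/64` (`Negative/F8ChainTwelve`) |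
| `14 … 30`, uniform rows | unchanged | `…LadderSummary.lean` |

WHAT IS OPEN (finite slices), updated: `θ₁₂ ∈ [57/64, 59/64)` — 31 candidate values `k/1024`, `913 ≤ k ≤ 943` (is `θ₁₂ = 57/64`?);
`θ₁₄ < 15/16`; every window above; whether any cubic pair at any `n` has `Φ ∈ (15/16, 1)`.

The theorems below are conjunctions / repackagings of cited declarations; axioms: `propext, Classical.choice, Quot.sound`.
-/

set_option linter.dupNamespace false -- D-0017: single-problem summit ⇒ `QuantumAdvantage.QuantumAdvantage` by design

noncomputable section

namespace Summit.QuantumAdvantage.QuantumAdvantage.Theorems.CubicForrelation.NearExactIsExact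

open Finset
open Literature.Computability.QuantumComplexity

/-! ### The refreshed rows -/

/-- **The row `n = 12` (2026-08-20): `θ₁₂ ∈ [57/64, 59/64)` together with the closed isolation `Φ ≥ 59/64 ⇒ Φ = 1` and the record
`Φ = 57/64 < 1`.**  Finite-slice verdict; NOT summit progress. [this work] -/
theorem lsb_twelve_row :
    (∃ θ₀ : ℝ, 57 / 64 ≤ θ₀ ∧ θ₀ < 59 / 64 ∧ IsLeast {θ : ℝ | ∀ f g : (Fin 12 → Bool) → Bool, IsDegLeFun 3 f → IsDegLeFun 3 g →
        θ < forrelation f g → forrelation f g = 1} θ₀) ∧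
    (∀ f g : (Fin 12 → Bool) → Bool, IsDegLeFun 3 f → IsDegLeFun 3 g → (59 / 64 : ℝ) ≤ forrelation f g → forrelation f g = 1) ∧
    (¬ ∃ f g : (Fin 12 → Bool) → Bool, IsDegLeFun 3 f ∧ IsDegLeFun 3 g ∧ forrelation f g = 59 / 64) :=
  ⟨theta_twelve_halfopen_5964, isolation_twelve_ge_5964, no_value_twelve_5964⟩

/-- **The certified windows `θ_n ∈ [a_n, b_n)` for `n = 12, 14, …, 30`, refreshed** (`n = 12`: `[57/64, 59/64)`; the other nine rows as in
`ls_ladder_windows`).  None of these windows is decided.  NOT summit progress. [this work] -/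
theorem lsb_ladder_windows :
    (∃ θ₀ : ℝ, 57 / 64 ≤ θ₀ ∧ θ₀ < 59 / 64 ∧ IsLeast {θ : ℝ | ∀ f g : (Fin 12 → Bool) → Bool, IsDegLeFun 3 f → IsDegLeFun 3 g →
        θ < forrelation f g → forrelation f g = 1} θ₀) ∧
    (∃ θ₀ : ℝ, 57 / 64 ≤ θ₀ ∧ θ₀ < 31 / 32 ∧ IsLeast {θ : ℝ | ∀ f g : (Fin 14 → Bool) → Bool, IsDegLeFun 3 f → IsDegLeFun 3 g →
        θ < forrelation f g → forrelation f g = 1} θ₀) ∧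
    (∃ θ₀ : ℝ, 15 / 16 ≤ θ₀ ∧ θ₀ < 31 / 32 ∧ IsLeast {θ : ℝ | ∀ f g : (Fin 16 → Bool) → Bool, IsDegLeFun 3 f → IsDegLeFun 3 g →
        θ < forrelation f g → forrelation f g = 1} θ₀) ∧
    (∃ θ₀ : ℝ, 15 / 16 ≤ θ₀ ∧ θ₀ < 63 / 64 ∧ IsLeast {θ : ℝ | ∀ f g : (Fin 18 → Bool) → Bool, IsDegLeFun 3 f → IsDegLeFun 3 g →
        θ < forrelation f g → forrelation f g = 1} θ₀) ∧
    (∃ θ₀ : ℝ, 15 / 16 ≤ θ₀ ∧ θ₀ < 127 / 128 ∧ IsLeast {θ : ℝ | ∀ f g : (Fin 20 → Bool) → Bool, IsDegLeFun 3 f → IsDegLeFun 3 g →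
        θ < forrelation f g → forrelation f g = 1} θ₀) ∧
    (∃ θ₀ : ℝ, 15 / 16 ≤ θ₀ ∧ θ₀ < 127 / 128 ∧ IsLeast {θ : ℝ | ∀ f g : (Fin 22 → Bool) → Bool, IsDegLeFun 3 f → IsDegLeFun 3 g →
        θ < forrelation f g → forrelation f g = 1} θ₀) ∧
    (∃ θ₀ : ℝ, 15 / 16 ≤ θ₀ ∧ θ₀ < 255 / 256 ∧ IsLeast {θ : ℝ | ∀ f g : (Fin 24 → Bool) → Bool, IsDegLeFun 3 f → IsDegLeFun 3 g →
        θ < forrelation f g → forrelation f g = 1} θ₀) ∧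
    (∃ θ₀ : ℝ, 15 / 16 ≤ θ₀ ∧ θ₀ < 511 / 512 ∧ IsLeast {θ : ℝ | ∀ f g : (Fin 26 → Bool) → Bool, IsDegLeFun 3 f → IsDegLeFun 3 g →
        θ < forrelation f g → forrelation f g = 1} θ₀) ∧
    (∃ θ₀ : ℝ, 15 / 16 ≤ θ₀ ∧ θ₀ < 511 / 512 ∧ IsLeast {θ : ℝ | ∀ f g : (Fin 28 → Bool) → Bool, IsDegLeFun 3 f → IsDegLeFun 3 g →
        θ < forrelation f g → forrelation f g = 1} θ₀) ∧
    (∃ θ₀ : ℝ, 15 / 16 ≤ θ₀ ∧ θ₀ < 1023 / 1024 ∧ IsLeast {θ : ℝ | ∀ f g : (Fin 30 → Bool) → Bool, IsDegLeFun 3 f → IsDegLeFun 3 g →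
        θ < forrelation f g → forrelation f g = 1} θ₀) :=
  ⟨theta_twelve_halfopen_5964, ls_ladder_windows.2⟩

/-! ### Second refresh (2026-08-20, later the same day): one rung lower at `n = 12` -/

/-- **The row `n = 12`, second refresh (2026-08-20): `θ₁₂ ∈ [57/64, 943/1024)` together with the closed isolation `Φ ≥ 943/1024 ⇒ Φ = 1`
and the empty window `[943/1024, 1)`** (`…TwelveClosed943`: type O `≤ 942/1024`, level 5 dead above `932/1024`, level `≥ 6` dead on
`[943/1024, 59/64)`).  The 31 candidates `913/1024 … 943/1024` of the first refresh shrink to `913/1024 … 942/1024`.  Finite-slice verdict;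
NOT summit progress. [this work] -/
theorem lsb_twelve_row_943 :
    (∃ θ₀ : ℝ, 57 / 64 ≤ θ₀ ∧ θ₀ < 943 / 1024 ∧ IsLeast {θ : ℝ | ∀ f g : (Fin 12 → Bool) → Bool, IsDegLeFun 3 f → IsDegLeFun 3 g →
        θ < forrelation f g → forrelation f g = 1} θ₀) ∧
    (∀ f g : (Fin 12 → Bool) → Bool, IsDegLeFun 3 f → IsDegLeFun 3 g → (943 / 1024 : ℝ) ≤ forrelation f g → forrelation f g = 1) ∧
    (¬ ∃ f g : (Fin 12 → Bool) → Bool, IsDegLeFun 3 f ∧ IsDegLeFun 3 g ∧ (943 / 1024 : ℝ) ≤ forrelation f g ∧ forrelation f g < 1) :=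
  ⟨theta_twelve_halfopen_943, isolation_twelve_ge_943, no_window_twelve_ge_943⟩

/-! ### Third refresh (2026-08-20/21, gen 16 index line for gen 15's last rung): two rungs lower again at `n = 12` -/

/-- **The row `n = 12`, third refresh: `θ₁₂ ∈ [57/64, 941/1024)` together with the closed isolation `Φ ≥ 941/1024 ⇒ Φ = 1`
and the empty window `[941/1024, 1)`** (`…TwelveClosed941`, gen 15: type O `≤ 940/1024` since RM(3,12) has no weight in `(768, 816]`,
level 5 dead above `932/1024`, level `≥ 6` dead on `[941/1024, 59/64)` at energy budget `664`).  The candidates for `θ₁₂` shrink to the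
28 values `913/1024 … 940/1024`; `940/1024` is where BOTH one-sided tools of gens 12–15 stop (type O: the Kasami–Tokura weights `832 … 880`
of RM(3,12) are not yet excluded in the tree; level `≥ 6`: the flat-`L¹` engine's budget ends at `Σe² = 664 < 672`).  Finite-slice verdict;
NOT summit progress. [this work; index only — no new mathematics] -/
theorem lsb_twelve_row_941 :
    (∃ θ₀ : ℝ, 57 / 64 ≤ θ₀ ∧ θ₀ < 941 / 1024 ∧ IsLeast {θ : ℝ | ∀ f g : (Fin 12 → Bool) → Bool, IsDegLeFun 3 f → IsDegLeFun 3 g →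
        θ < forrelation f g → forrelation f g = 1} θ₀) ∧
    (∀ f g : (Fin 12 → Bool) → Bool, IsDegLeFun 3 f → IsDegLeFun 3 g → (941 / 1024 : ℝ) ≤ forrelation f g → forrelation f g = 1) ∧
    (¬ ∃ f g : (Fin 12 → Bool) → Bool, IsDegLeFun 3 f ∧ IsDegLeFun 3 g ∧ (941 / 1024 : ℝ) ≤ forrelation f g ∧ forrelation f g < 1) :=
  ⟨theta_twelve_halfopen_941, isolation_twelve_ge_941, no_window_twelve_ge_941⟩

/-! ### Fourth refresh (2026-08-21, gen 16): both `940/1024` barriers broken — `θ₁₂ < 937/1024` -/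

/-- **The row `n = 12`, fourth refresh: `θ₁₂ ∈ [57/64, 937/1024)` together with the closed isolation `Φ ≥ 937/1024 ⇒ Φ = 1`
and the empty window `[937/1024, 1)`** (`…TwelveClosed937`, gen 16: type O `≤ 936/1024` by the Kasami–Tokura gap of `RM(3,12)` —
`kt_gap_twelve`, no cubic weight in `(768, 896)`, proved for every `m` as `kt_gap_cubic` —, level 5 dead above `932/1024`, level `≥ 6` dead on
`[937/1024, 59/64)` by gen 13's engine with exact accounting by cost class at budget `696` and the two-sided kill tolerating `|e| = 7` points).
The candidates for `θ₁₂` shrink to the 24 values `913/1024 … 936/1024`; at `936/1024` both tools stop again (a type-O base set of size `896` at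
zero excess; four cost-`48` wild points in the engine).  Finite-slice verdict; NOT summit progress. [this work; index only — no new mathematics] -/
theorem lsb_twelve_row_937 :
    (∃ θ₀ : ℝ, 57 / 64 ≤ θ₀ ∧ θ₀ < 937 / 1024 ∧ IsLeast {θ : ℝ | ∀ f g : (Fin 12 → Bool) → Bool, IsDegLeFun 3 f → IsDegLeFun 3 g →
        θ < forrelation f g → forrelation f g = 1} θ₀) ∧
    (∀ f g : (Fin 12 → Bool) → Bool, IsDegLeFun 3 f → IsDegLeFun 3 g → (937 / 1024 : ℝ) ≤ forrelation f g → forrelation f g = 1) ∧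
    (¬ ∃ f g : (Fin 12 → Bool) → Bool, IsDegLeFun 3 f ∧ IsDegLeFun 3 g ∧ (937 / 1024 : ℝ) ≤ forrelation f g ∧ forrelation f g < 1) :=
  ⟨theta_twelve_halfopen_937, isolation_twelve_ge_937, no_window_twelve_ge_937⟩

/-- **The row `n = 12`, fifth refresh: `θ₁₂ ∈ [57/64, 936/1024)` together with the closed isolation `Φ ≥ 936/1024 ⇒ Φ = 1`
and the empty window `[936/1024, 1)`** (`…TwelveClosed936`, gen 18: the common wall `936/1024 = 117/128` of both one-sided tools is NOT
attained — type O: a base set of `896` points at zero excess forces the partner to be bent, because the half weights of a weight-`896` cubic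
support are cubic weights on 11 bits, `to18_typeO_ge936_false`; level `≥ 6` at `Σ e² = 704`: gen 16's off-flat lemma at the boundary energy
`192` with the new RIGID exceptions handled by few-hit transversal directions, `tw18_dirs_few_hits` / `tw18_H34_rigid`, and the two-sided kills).
The candidates for `θ₁₂` shrink to the 23 values `913/1024 … 935/1024`.  Finite-slice verdict; NOT summit progress. [this work; index only —
no new mathematics] -/
theorem lsb_twelve_row_936 :
    (∃ θ₀ : ℝ, 57 / 64 ≤ θ₀ ∧ θ₀ < 936 / 1024 ∧ IsLeast {θ : ℝ | ∀ f g : (Fin 12 → Bool) → Bool, IsDegLeFun 3 f → IsDegLeFun 3 g →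
        θ < forrelation f g → forrelation f g = 1} θ₀) ∧
    (∀ f g : (Fin 12 → Bool) → Bool, IsDegLeFun 3 f → IsDegLeFun 3 g → (936 / 1024 : ℝ) ≤ forrelation f g → forrelation f g = 1) ∧
    (¬ ∃ f g : (Fin 12 → Bool) → Bool, IsDegLeFun 3 f ∧ IsDegLeFun 3 g ∧ (936 / 1024 : ℝ) ≤ forrelation f g ∧ forrelation f g < 1) :=
  ⟨theta_twelve_halfopen_936, isolation_twelve_ge_936, no_window_twelve_ge_936⟩

/-- **The row `n = 12`, sixth refresh: `θ₁₂ ∈ [57/64, 935/1024)` together with the closed isolation `Φ ≥ 935/1024 ⇒ Φ = 1`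
and the empty window `[935/1024, 1)`** (`…TwelveClosed935`, gen 18: type O at `935` dies WITHOUT Kasami–Tokura — the base set `904` by a
mod-16 character argument and Parseval for the wild function, the base set `912` by zero excess and the self-dual rigidity at the character point,
`to18_typeO_ge935_false`; level `≥ 6` at `Σ e² = 712` by gen 16's engine with a symbolic budget (`…Eight719`), the off-flat lemma at energy `200`
and the rigid kill with up to `50` exceptional points, `tw18_H34_rigid63`).  The candidates for `θ₁₂` shrink to the 22 values `913/1024 … 934/1024`.
Finite-slice verdict; NOT summit progress. [this work; index only — no new mathematics] -/
theorem lsb_twelve_row_935 :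
    (∃ θ₀ : ℝ, 57 / 64 ≤ θ₀ ∧ θ₀ < 935 / 1024 ∧ IsLeast {θ : ℝ | ∀ f g : (Fin 12 → Bool) → Bool, IsDegLeFun 3 f → IsDegLeFun 3 g →
        θ < forrelation f g → forrelation f g = 1} θ₀) ∧
    (∀ f g : (Fin 12 → Bool) → Bool, IsDegLeFun 3 f → IsDegLeFun 3 g → (935 / 1024 : ℝ) ≤ forrelation f g → forrelation f g = 1) ∧
    (¬ ∃ f g : (Fin 12 → Bool) → Bool, IsDegLeFun 3 f ∧ IsDegLeFun 3 g ∧ (935 / 1024 : ℝ) ≤ forrelation f g ∧ forrelation f g < 1) :=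
  ⟨theta_twelve_halfopen_935, isolation_twelve_ge_935, no_window_twelve_ge_935⟩

/-- **The row `n = 12`, seventh refresh: `θ₁₂ ∈ [57/64, 934/1024)` together with the closed isolation `Φ ≥ 934/1024 ⇒ Φ = 1`
and the empty window `[934/1024, 1)`** (`…TwelveClosed934`, gen 18: type O at `934` dies because the zero-excess base set `912` would carry an
8-point wild set making `E` invariant under two distinct translations — impossible for a cubic support of `912` points by two coordinate
restrictions and Ax's theorem on 10 bits, `to18_typeO_ge934_false`; level `≥ 6` at `Σ e² = 720` by the engine at budget `≤ 735`, the off-flat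
lemma at energy `208` (one exceptional `e = ±4` point, handled by WEIGHTED few-hit transversals, `tw18_H34_rigid_w`) and the two-sided sparse kill
tolerating a `|e| = 9` point on the flat, `tw18_levelSix_sparse9_false`).  The candidates for `θ₁₂` shrink to the 21 values `913/1024 … 933/1024`.
Finite-slice verdict; NOT summit progress. [this work; index only — no new mathematics] -/
theorem lsb_twelve_row_934 :
    (∃ θ₀ : ℝ, 57 / 64 ≤ θ₀ ∧ θ₀ < 934 / 1024 ∧ IsLeast {θ : ℝ | ∀ f g : (Fin 12 → Bool) → Bool, IsDegLeFun 3 f → IsDegLeFun 3 g →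
        θ < forrelation f g → forrelation f g = 1} θ₀) ∧
    (∀ f g : (Fin 12 → Bool) → Bool, IsDegLeFun 3 f → IsDegLeFun 3 g → (934 / 1024 : ℝ) ≤ forrelation f g → forrelation f g = 1) ∧
    (¬ ∃ f g : (Fin 12 → Bool) → Bool, IsDegLeFun 3 f ∧ IsDegLeFun 3 g ∧ (934 / 1024 : ℝ) ≤ forrelation f g ∧ forrelation f g < 1) :=
  ⟨theta_twelve_halfopen_934, isolation_twelve_ge_934, no_window_twelve_ge_934⟩

/-- **The row `n = 12`, eighth refresh: `θ₁₂ ∈ [57/64, 933/1024)` together with the closed isolation `Φ ≥ 933/1024 ⇒ Φ = 1`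
and the empty window `[933/1024, 1)`** (`…TwelveClosed933`, gen 18: the TYPE-O branch is closed on all of `(932/1024, 936/1024]` at once by the
classification-free SECOND Kasami–Tokura gap — no cubic on 12 bits has weight in `(896, 960)`, `kt_gap2_twelve`, `to18_typeO_le_932` —; level
`≥ 6` at `Σ e² = 728` by the engine at budget `≤ 735`, the off-flat lemma at energy `216` (up to TWO exceptional `e = ±4` points, handled by
WEIGHTED few-hit transversals with weight `2` on both, `tw18_H34_rigid_w2`) and the two-sided sparse kills).  The candidates for `θ₁₂` shrink
to the 20 values `913/1024 … 932/1024`; below `933/1024` the level-5 branch (`tw15_levelFive_932_false`) has to be reopened.  Finite-slice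
verdict; NOT summit progress. [this work; index only — no new mathematics] -/
theorem lsb_twelve_row_933 :
    (∃ θ₀ : ℝ, 57 / 64 ≤ θ₀ ∧ θ₀ < 933 / 1024 ∧ IsLeast {θ : ℝ | ∀ f g : (Fin 12 → Bool) → Bool, IsDegLeFun 3 f → IsDegLeFun 3 g →
        θ < forrelation f g → forrelation f g = 1} θ₀) ∧
    (∀ f g : (Fin 12 → Bool) → Bool, IsDegLeFun 3 f → IsDegLeFun 3 g → (933 / 1024 : ℝ) ≤ forrelation f g → forrelation f g = 1) ∧
    (¬ ∃ f g : (Fin 12 → Bool) → Bool, IsDegLeFun 3 f ∧ IsDegLeFun 3 g ∧ (933 / 1024 : ℝ) ≤ forrelation f g ∧ forrelation f g < 1) :=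
  ⟨theta_twelve_halfopen_933, isolation_twelve_ge_933, no_window_twelve_ge_933⟩

/-- **The row `n = 12`, ninth refresh: `θ₁₂ ∈ [57/64, 932/1024] = [228/256, 233/256]` together with the OPEN isolation `Φ > 932/1024 ⇒ Φ = 1`
and the empty open window `(932/1024, 1)`** (`…TwelveOpen932`, gen 18: above `932/1024` the type-O branch (`to18_typeO_le_932`, second
Kasami–Tokura gap) and the level-5 branch (`tw15_levelFive_932_false`) are dead and the level-`≥ 6` budget `Σ e² < 736` is an integer `≤ 735`,
inside the engine's exact accounting; off-flat lemma at energy `≤ 223`).  The candidates for `θ₁₂` are now the 21 values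
`912/1024 = 57/64, 913/1024, …, 932/1024`; `θ₁₂ = 233/256` exactly iff some cubic pair on 12 bits has `Φ = 932/1024` (three sharp boundary
configurations remain there: type O with `#E ∈ {896, 960}`, the level-5 cascade at `S = 896`, level `≥ 6` at `Σ e² = 736`).  Finite-slice
verdict; NOT summit progress. [this work; index only — no new mathematics] -/
theorem lsb_twelve_row_le932 :
    (∃ θ₀ : ℝ, 57 / 64 ≤ θ₀ ∧ θ₀ ≤ 932 / 1024 ∧ IsLeast {θ : ℝ | ∀ f g : (Fin 12 → Bool) → Bool, IsDegLeFun 3 f → IsDegLeFun 3 g →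
        θ < forrelation f g → forrelation f g = 1} θ₀) ∧
    (∀ f g : (Fin 12 → Bool) → Bool, IsDegLeFun 3 f → IsDegLeFun 3 g → (932 / 1024 : ℝ) < forrelation f g → forrelation f g = 1) ∧
    (¬ ∃ f g : (Fin 12 → Bool) → Bool, IsDegLeFun 3 f ∧ IsDegLeFun 3 g ∧ (932 / 1024 : ℝ) < forrelation f g ∧ forrelation f g < 1) :=
  ⟨theta_twelve_le_932, isolation_twelve_gt_932, no_window_twelve_gt_932⟩

/-- **ROW `n = 12`, rung `233/256 = 932/1024` CLOSED (gen 18)**: `θ₁₂ ∈ [57/64, 14911/16384]` — the value `932/1024` is NOT attained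
(`isolation_twelve_ge_932`: `Φ ≥ 932/1024 ⇒ Φ = 1`, …TwelveT1Dead: type O ⇒ base `960` with a level-`≥ 6` partner, level 5 dead, level `≥ 6` ×
level `≥ 6` dead, and the (type O, base 960) × (level ≥ 6) configuration dead by the sigma-support counting engine — classification-free), and by
value granularity `Φ ∈ 2⁻¹⁴ℤ` the threshold drops to `932/1024 − 2⁻¹⁴ = 14911/16384` (`theta_twelve_lt_932`).  Undecided: `913/1024 … 931/1024`.
Finite-slice verdict; NOT summit progress. [this work; index only — no new mathematics] -/
theorem lsb_twelve_row_lt932 :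
    (∃ θ₀ : ℝ, 57 / 64 ≤ θ₀ ∧ θ₀ ≤ 14911 / 16384 ∧ IsLeast {θ : ℝ | ∀ f g : (Fin 12 → Bool) → Bool, IsDegLeFun 3 f → IsDegLeFun 3 g →
        θ < forrelation f g → forrelation f g = 1} θ₀) ∧
    (∀ f g : (Fin 12 → Bool) → Bool, IsDegLeFun 3 f → IsDegLeFun 3 g → (932 / 1024 : ℝ) ≤ forrelation f g → forrelation f g = 1) ∧
    (¬ ∃ f g : (Fin 12 → Bool) → Bool, IsDegLeFun 3 f ∧ IsDegLeFun 3 g ∧ (932 / 1024 : ℝ) ≤ forrelation f g ∧ forrelation f g < 1) :=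
  ⟨theta_twelve_lt_932, isolation_twelve_ge_932, no_window_twelve_ge_932⟩

/-- **ROW `n = 12`, rungs `931/1024` and `930.5/1024` CLOSED (gen 20)**: `θ₁₂ ∈ [57/64, 930/1024]` — NO cubic pair on 12 bits has
`930/1024 < Φ < 1` (`isolation_twelve_gt_930`, …TwelveClosed931: above `930/1024` both sides are at Ax level `≥ 6` by gen 19's
`to19_window_gt930_levelSix` — type O dead by the Kasami–Tokura-for-cubics base-set analysis `kt3_structure_twelve`, level 5 dead by gen 18's
cascade — and level `≥ 6` × level `≥ 6` is dead by the off-flat trichotomy at every energy `< 240` with up to three exceptional points,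
`tw20_levelSix_both_gt930_false`).  Undecided: `913/1024 … 930/1024`.  Finite-slice verdict; NOT summit progress. [this work; index only — no
new mathematics] -/
theorem lsb_twelve_row_le930 :
    (∃ θ₀ : ℝ, 57 / 64 ≤ θ₀ ∧ θ₀ ≤ 930 / 1024 ∧ IsLeast {θ : ℝ | ∀ f g : (Fin 12 → Bool) → Bool, IsDegLeFun 3 f → IsDegLeFun 3 g →
        θ < forrelation f g → forrelation f g = 1} θ₀) ∧
    (∀ f g : (Fin 12 → Bool) → Bool, IsDegLeFun 3 f → IsDegLeFun 3 g → (930 / 1024 : ℝ) < forrelation f g → forrelation f g = 1) ∧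
    (¬ ∃ f g : (Fin 12 → Bool) → Bool, IsDegLeFun 3 f ∧ IsDegLeFun 3 g ∧ (930 / 1024 : ℝ) < forrelation f g ∧ forrelation f g < 1) :=
  ⟨theta_twelve_le_930, isolation_twelve_gt_930, no_window_twelve_gt_930⟩

/-- **ROW `n = 12`, rung `465/512 = 930/1024` CLOSED (gen 20)**: `θ₁₂ ∈ [57/64, 14879/16384]` — the value `930/1024` is NOT attained
(`isolation_twelve_ge_930`: `Φ ≥ 930/1024 ⇒ Φ = 1`, …TwelveClosed930: type O dead by …TwelveTypeO930Dead (base `992`, zero excess, the partner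
identity + Kasami–Tokura-for-cubics make the partner a level-5 side), level 5 dead by …TwelveLevelFive930Dead (straddling 5-flats, granularity of
the hyperplane character sums, `W_f = 64(−1)^g − 32m − 4r̂`), level `≥ 6` × level `≥ 6` dead by …TwelveLevelSixBothGe930 (off-flat trichotomy at
energy `≤ 240`, ℓ¹ engine at `B = 752`)), and by value granularity the threshold drops to `930/1024 − 2⁻¹⁴ = 14879/16384` (`theta_twelve_lt_930`).
Undecided: `913/1024 … 929/1024`.  Finite-slice verdict; NOT summit progress. [this work; index only — no new mathematics] -/
theorem lsb_twelve_row_lt930 :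
    (∃ θ₀ : ℝ, 57 / 64 ≤ θ₀ ∧ θ₀ ≤ 14879 / 16384 ∧ IsLeast {θ : ℝ | ∀ f g : (Fin 12 → Bool) → Bool, IsDegLeFun 3 f → IsDegLeFun 3 g →
        θ < forrelation f g → forrelation f g = 1} θ₀) ∧
    (∀ f g : (Fin 12 → Bool) → Bool, IsDegLeFun 3 f → IsDegLeFun 3 g → (930 / 1024 : ℝ) ≤ forrelation f g → forrelation f g = 1) ∧
    (¬ ∃ f g : (Fin 12 → Bool) → Bool, IsDegLeFun 3 f ∧ IsDegLeFun 3 g ∧ (930 / 1024 : ℝ) ≤ forrelation f g ∧ forrelation f g < 1) :=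
  ⟨theta_twelve_lt_930, isolation_twelve_ge_930, no_window_twelve_ge_930⟩

/-- **ROW `n = 12`, rung `929/1024` CLOSED (gen 20)**: `θ₁₂ ∈ [57/64, 14863/16384]` — the value `929/1024` is NOT attained
(`isolation_twelve_ge_929`: `Φ ≥ 929/1024 ⇒ Φ = 1`, …TwelveClosed929: type O dead by …TwelveTypeO929Dead (bases `512` / `960` / `992`: one wild
point in case A, resp. the wild-function engines — partner identity with the wild term, Parseval), level 5 dead by …TwelveLevelFive929Reduction (the
partner would be a base-`512` type-O side), level `≥ 6` × level `≥ 6` dead by …TwelveLevelSixBothGe929), and by value granularity the threshold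
drops to `929/1024 − 2⁻¹⁴ = 14863/16384` (`theta_twelve_lt_929`).  Undecided: `913/1024 … 928/1024`.  Finite-slice verdict; NOT summit progress.
[this work; index only — no new mathematics] -/
theorem lsb_twelve_row_lt929 :
    (∃ θ₀ : ℝ, 57 / 64 ≤ θ₀ ∧ θ₀ ≤ 14863 / 16384 ∧ IsLeast {θ : ℝ | ∀ f g : (Fin 12 → Bool) → Bool, IsDegLeFun 3 f → IsDegLeFun 3 g →
        θ < forrelation f g → forrelation f g = 1} θ₀) ∧
    (∀ f g : (Fin 12 → Bool) → Bool, IsDegLeFun 3 f → IsDegLeFun 3 g → (929 / 1024 : ℝ) ≤ forrelation f g → forrelation f g = 1) ∧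
    (¬ ∃ f g : (Fin 12 → Bool) → Bool, IsDegLeFun 3 f ∧ IsDegLeFun 3 g ∧ (929 / 1024 : ℝ) ≤ forrelation f g ∧ forrelation f g < 1) :=
  ⟨theta_twelve_lt_929, isolation_twelve_ge_929, no_window_twelve_ge_929⟩

/-- **ROW `n = 12`, rung `29/32 = 928/1024` from ABOVE (gen 22)**: `θ₁₂ ∈ [57/64, 29/32]` — no value in the open window `(29/32, 1)`
(`isolation_twelve_gt_2932`, …TwelveClosedGt2932: type-O bases `992 / 960 / 512` below `929` and at `29/32`, level-5 partner analysis, level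
`≥ 6` × level `≥ 6` above `29/32`).  Finite-slice verdict; NOT summit progress. [this work; index only — no new mathematics] -/
theorem lsb_twelve_row_le2932 :
    (∃ θ₀ : ℝ, 57 / 64 ≤ θ₀ ∧ θ₀ ≤ 29 / 32 ∧ IsLeast {θ : ℝ | ∀ f g : (Fin 12 → Bool) → Bool, IsDegLeFun 3 f → IsDegLeFun 3 g →
        θ < forrelation f g → forrelation f g = 1} θ₀) ∧
    (∀ f g : (Fin 12 → Bool) → Bool, IsDegLeFun 3 f → IsDegLeFun 3 g → (29 / 32 : ℝ) < forrelation f g → forrelation f g = 1) ∧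
    (¬ ∃ f g : (Fin 12 → Bool) → Bool, IsDegLeFun 3 f ∧ IsDegLeFun 3 g ∧ (29 / 32 : ℝ) < forrelation f g ∧ forrelation f g < 1) :=
  ⟨theta_twelve_le_2932, isolation_twelve_gt_2932, no_window_twelve_gt_2932⟩

/-- **ROW `n = 12`, rung `29/32 = 928/1024` CLOSED (gens 23–25)**: `θ₁₂ ∈ [57/64, 14847/16384]` — the boundary value `29/32` is NOT attained
(`isolation_twelve_ge_2932`: `Φ ≥ 29/32 ⇒ Φ = 1`, …TwelveBetaDead: at `29/32 ≤ Φ < 1` both sides are level 6 with `Σe² = 768`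
(…TwelveBoundary2932Reduction2, gen 23: type O dead by the five-flat lemma, level 5 dead by the R1/R2/(c) analysis), configuration (γ)
`#Z = 512` dead by the 5-flat congruence + rank analysis (…TwelveLevelSixGammaDead, gen 25), configuration (β) × (β) `#Z = 768` dead by the
period group of the weight-768 even set, the transversal 5-flat identity and affine sign patterns (…TwelveBeta{Cosets,Labels,Transversal,Affine,Dead},
gen 25)), and by value granularity the threshold drops to `29/32 − 2⁻¹⁴ = 14847/16384` (`theta_twelve_lt_2932`).  Undecided: `913/1024 … 927/1024`.
Finite-slice verdict; NOT summit progress. [this work; index only — no new mathematics] -/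
theorem lsb_twelve_row_lt2932 :
    (∃ θ₀ : ℝ, 57 / 64 ≤ θ₀ ∧ θ₀ ≤ 14847 / 16384 ∧ IsLeast {θ : ℝ | ∀ f g : (Fin 12 → Bool) → Bool, IsDegLeFun 3 f → IsDegLeFun 3 g →
        θ < forrelation f g → forrelation f g = 1} θ₀) ∧
    (∀ f g : (Fin 12 → Bool) → Bool, IsDegLeFun 3 f → IsDegLeFun 3 g → (29 / 32 : ℝ) ≤ forrelation f g → forrelation f g = 1) ∧
    (¬ ∃ f g : (Fin 12 → Bool) → Bool, IsDegLeFun 3 f ∧ IsDegLeFun 3 g ∧ (29 / 32 : ℝ) ≤ forrelation f g ∧ forrelation f g < 1) :=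
  ⟨theta_twelve_lt_2932, isolation_twelve_ge_2932, no_window_twelve_ge_2932⟩

end Summit.QuantumAdvantage.QuantumAdvantage.Theorems.CubicForrelation.NearExactIsExact

end
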